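import Literature.NumberTheory.LFunctions.WeilFinitePrimeQuadratic
import Literature.NumberTheory.LFunctions.WeilGroundEnergyProofs
import HarnessLib

/-!
# The `{2,3,4}`-form versus the two-prime form beyond `log 2`: the sliver bound

Topic `Literature/NumberTheory/LFunctions`.  On the `{2,3,4}`-window `log 2 < c ≤ (log 5)/2` Weil's quadratic functional of
a test function `g` supported in `[-c, c]` is the `{2,3,4}`-form `E₂₃₄(g)` (`weilQuadratic_re_eq_weilThreePrimeQuadratic`,
`WeilFinitePrimeQuadratic.lean`), which differs from the two-prime form `E₂₃(g)` (`WeilTwoPrimeQuadratic.lean`) by the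
spike of the prime power `4 = 2²`:

  `E₂₃₄(g) − E₂₃(g) = −(log 2)/(2π) ∫ |ĝ(1/2+it)|² cos(t log 4) dt = −(log 2)/2 · (k(log 4) + k(−log 4))`,
  `k = g ⋆ g̃`, `k(x) = ∫ g(u) conj g(u − x) du`

(Mellin inversion `weilConv_weilReflect_add_eq_integral`).  For a shift `x > c` the integrand of `k(x)` lives
on the SLIVER `u ∈ [x − c, c]` while `u − x ∈ [−c, c − x]`, two DISJOINT sub-intervals of the window, so
`2|g(u)||g(u − x)| ≤ |g(u)|² + |g(u − x)|²` integrates to `|k(x)| ≤ ½ ‖g‖₂²` (**`norm_weilConv_weilReflect_le_half`**, a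
sharpening of Bombieri's `|k(x)| ≤ ‖g‖₂²`, `norm_weilConv_weilReflect_le`).  Consequently

  **`|E₂₃₄(g) − E₂₃(g)| ≤ (log 2)/2 · ‖g‖₂²`  for `tsupport g ⊆ [-c, c]`, `c < log 4`**

(`abs_weilThreePrimeQuadratic_sub_weilTwoPrimeQuadratic_le`, and the one-sided
`weilTwoPrimeQuadratic_sub_le_weilThreePrimeQuadratic`).  Use: a TWO-prime moment certificate
(`WeilTwoPrimeCertificateDeflated.lean`) at level `β₂₃` on a window `c ∈ (log 2, (log 5)/2]` yields the complement level
`β = β₂₃ − (log 2)/2` for the true form `Re Q = E₂₃₄` — the `β`-certificate of the deflated Temple / Lehmann–Maehly L-sides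
of the parity ladder beyond `log 2` needs no three-ripple cell machinery.  All proved; no named facts.

## References
* E. Bombieri, *Remarks on Weil's quadratic functional in the theory of prime numbers I*, Rend. Mat. Acc. Lincei (9) 11
  (2000), §4 Lemma 2 (`|(f * g*)(x)| ≤ ‖f‖‖g‖`), Thm 2 (explicit formula). [Bombieri2000]
* H. Yoshida, *On Hermitian forms attached to zeta functions*, Adv. Stud. Pure Math. 21 (1992), §2 eq. (2.1). [Yoshida1992]
-/

noncomputable section

open Complex Filter Set MeasureTheory
open scoped Real Topology ComplexConjugate

namespace Literature.NumberTheory.LFunctions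

variable {g : ℝ → ℂ}

/-! ## The sliver bound for the autocorrelation at a large shift -/

/-- **Sliver bound.** For a test function `g` supported in `[-c, c]` and a shift `x > c`:
`|k(x)| = |∫ g(u) conj g(u − x) du| ≤ ½ ‖g‖₂²` — the integrand lives on `u ∈ [x − c, c]`, `u − x ∈ [−c, c − x]`, two disjoint
parts of the window, and `2|g(u)||g(u−x)| ≤ |g(u)|² + |g(u−x)|²`. [cite: Bombieri2000, §4 Lemma 2 (sharpened on a sliver)] -/
theorem norm_weilConv_weilReflect_le_half (hg : IsWeilTest g) {c x : ℝ} (hsupp : tsupport g ⊆ Icc (-c) c)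
    (hx : c < x) : ‖weilConv g (weilReflect g) x‖ ≤ (∫ u : ℝ, ‖g u‖ ^ 2) / 2 := by
  have h2 : Integrable fun u : ℝ ↦ ‖g u‖ ^ 2 := hg.integrable_norm_sq
  -- the two indicator-weighted majorants
  set φ : ℝ → ℝ := (Ici (x - c)).indicator fun u ↦ ‖g u‖ ^ 2 with hφ
  set ψ : ℝ → ℝ := (Iic (c - x)).indicator fun u ↦ ‖g u‖ ^ 2 with hψ
  have hφi : Integrable φ := h2.indicator measurableSet_Ici
  have hψi : Integrable ψ := h2.indicator measurableSet_Iic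
  have hψi' : Integrable fun u : ℝ ↦ ψ (u - x) := hψi.comp_sub_right x
  have hφ0 : ∀ u, 0 ≤ φ u := fun u ↦ Set.indicator_nonneg (fun _ _ ↦ by positivity) u
  have hψ0 : ∀ u, 0 ≤ ψ u := fun u ↦ Set.indicator_nonneg (fun _ _ ↦ by positivity) u
  have hzero : ∀ u, g u ≠ 0 → u ∈ Icc (-c) c := fun u hu ↦ hsupp (subset_tsupport _ hu)
  -- pointwise: 2 |g(u)| |g(u − x)| ≤ φ(u) + ψ(u − x)
  have hpt : ∀ u, ‖g u * weilReflect g (x - u)‖ ≤ (φ u + ψ (u - x)) / 2 := by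
    intro u
    simp only [weilReflect, norm_mul, Complex.norm_conj, neg_sub]
    by_cases hgu : g u = 0
    · rw [hgu, norm_zero, zero_mul]; linarith [hφ0 u, hψ0 (u - x)]
    by_cases hgv : g (u - x) = 0
    · rw [hgv, norm_zero, mul_zero]; linarith [hφ0 u, hψ0 (u - x)]
    have hu := hzero u hgu
    have hv := hzero (u - x) hgv
    have h1 : u ∈ Ici (x - c) := by simp only [mem_Ici]; linarith [hv.1]
    have h2' : u - x ∈ Iic (c - x) := by simp only [mem_Iic]; linarith [hu.2]
    rw [hφ, hψ, Set.indicator_of_mem h1, Set.indicator_of_mem h2']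
    linarith [two_mul_le_add_sq ‖g u‖ ‖g (u - x)‖]
  -- the two indicators are disjoint parts of the line: φ + ψ ≤ |g|²
  have hsum : ∀ u, φ u + ψ u ≤ ‖g u‖ ^ 2 := by
    intro u
    by_cases h1 : u ∈ Ici (x - c)
    · have h2' : u ∉ Iic (c - x) := by
        simp only [mem_Ici, mem_Iic, not_le] at h1 ⊢; linarith
      rw [hφ, hψ, Set.indicator_of_mem h1, Set.indicator_of_notMem h2']; linarith
    · rw [hφ, Set.indicator_of_notMem h1, zero_add, hψ]
      exact Set.indicator_le_self' (fun _ _ ↦ by positivity) u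
  rw [weilConv_apply]
  calc ‖∫ u : ℝ, g u * weilReflect g (x - u)‖
      ≤ ∫ u : ℝ, ‖g u * weilReflect g (x - u)‖ := norm_integral_le_integral_norm _
    _ ≤ ∫ u : ℝ, (φ u + ψ (u - x)) / 2 :=
        integral_mono_of_nonneg (Eventually.of_forall fun _ ↦ norm_nonneg _)
          ((hφi.add hψi').div_const 2) (Eventually.of_forall hpt)
    _ = ((∫ u : ℝ, φ u) + ∫ u : ℝ, ψ u) / 2 := by
        rw [integral_div, integral_add hφi hψi', integral_sub_right_eq_self ψ x]
    _ = (∫ u : ℝ, φ u + ψ u) / 2 := by rw [integral_add hφi hψi]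
    _ ≤ (∫ u : ℝ, ‖g u‖ ^ 2) / 2 :=
        div_le_div_of_nonneg_right (integral_mono (hφi.add hψi) h2 hsum) (by norm_num)

/-- The sliver bound for both shifts `±x`: `|k(x) + k(−x)| ≤ ‖g‖₂²` (`k(−x) = conj k(x)`). [cite: Bombieri2000, §4 Lemma 2 (sharpened on a sliver)] -/
theorem norm_weilConv_weilReflect_add_neg_le (hg : IsWeilTest g) {c x : ℝ} (hsupp : tsupport g ⊆ Icc (-c) c)
    (hx : c < x) :
    ‖weilConv g (weilReflect g) x + weilConv g (weilReflect g) (-x)‖ ≤ ∫ u : ℝ, ‖g u‖ ^ 2 := by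
  have h := norm_weilConv_weilReflect_le_half hg hsupp hx
  have h' : ‖weilConv g (weilReflect g) (-x)‖ ≤ (∫ u : ℝ, ‖g u‖ ^ 2) / 2 := by
    rw [← conj_weilConv_weilReflect_neg, Complex.norm_conj] at h; exact h
  calc ‖weilConv g (weilReflect g) x + weilConv g (weilReflect g) (-x)‖
      ≤ ‖weilConv g (weilReflect g) x‖ + ‖weilConv g (weilReflect g) (-x)‖ := norm_add_le _ _
    _ ≤ ∫ u : ℝ, ‖g u‖ ^ 2 := by linarith

/-! ## The `{2,3,4}`-form minus the two-prime form -/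

/-- **The spike of the prime power `4` in analytic form**:
`E₂₃₄(g) − E₂₃(g) = −(log 2)/2 · Re(k(log 4) + k(−log 4))`, `k = g ⋆ g̃`
(`w₂₃₄ = w₂₃ − log 2 · cos(t log 4)` and Mellin inversion `k(x) + k(−x) = (1/2π)∫|ĝ|² 2cos(tx)`). [cite: Yoshida1992, §2 eq. (2.1) (the p^m = 4 term)] -/
theorem weilThreePrimeQuadratic_sub_weilTwoPrimeQuadratic (hg : IsWeilTest g) :
    weilThreePrimeQuadratic g - weilTwoPrimeQuadratic g =
      -(Real.log 2 / 2) *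
        (weilConv g (weilReflect g) (Real.log 4) + weilConv g (weilReflect g) (-Real.log 4)).re := by
  have hI23 := integrable_norm_sq_weilMellin_mul_weilTwoPrimeWeight hg
  have hIc : Integrable fun t : ℝ ↦ ‖weilMellin g (1 / 2 + t * I)‖ ^ 2 * (2 * Real.cos (t * Real.log 4)) :=
    integrable_norm_sq_weilMellin_mul_two_cos hg (Real.log 4)
  have hsplit : ∫ t : ℝ, ‖weilMellin g (1 / 2 + t * I)‖ ^ 2 * weilThreePrimeWeight t =
      (∫ t : ℝ, ‖weilMellin g (1 / 2 + t * I)‖ ^ 2 * weilTwoPrimeWeight t) -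
        Real.log 2 / 2 * ∫ t : ℝ, ‖weilMellin g (1 / 2 + t * I)‖ ^ 2 * (2 * Real.cos (t * Real.log 4)) := by
    have e : (fun t : ℝ ↦ ‖weilMellin g (1 / 2 + t * I)‖ ^ 2 * weilThreePrimeWeight t) =
        fun t : ℝ ↦ ‖weilMellin g (1 / 2 + t * I)‖ ^ 2 * weilTwoPrimeWeight t -
          Real.log 2 / 2 * (‖weilMellin g (1 / 2 + t * I)‖ ^ 2 * (2 * Real.cos (t * Real.log 4))) := by
      funext t; unfold weilThreePrimeWeight; ring
    rw [e, integral_sub hI23 (hIc.const_mul _), integral_const_mul]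
  have hk := weilConv_weilReflect_add_eq_integral hg (Real.log 4)
  have hre : (weilConv g (weilReflect g) (Real.log 4) + weilConv g (weilReflect g) (-Real.log 4)).re =
      1 / (2 * π) * ∫ t : ℝ, ‖weilMellin g (1 / 2 + t * I)‖ ^ 2 * (2 * Real.cos (t * Real.log 4)) := by
    rw [hk, show (1 / (2 * π) : ℂ) = ((1 / (2 * π) : ℝ) : ℂ) by push_cast; ring, ← Complex.ofReal_mul,
      Complex.ofReal_re]
  unfold weilThreePrimeQuadratic weilTwoPrimeQuadratic
  rw [hsplit, hre]
  ring

/-- **The sliver bound for the `{2,3,4}`-form**: for a test function `g` with `tsupport g ⊆ [-c, c]`, `c < log 4`,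
`|E₂₃₄(g) − E₂₃(g)| ≤ (log 2)/2 · ‖g‖₂²`. [cite: Yoshida1992, §2 eq. (2.1) (the p^m = 4 term); Bombieri2000, §4 Lemma 2] -/
theorem abs_weilThreePrimeQuadratic_sub_weilTwoPrimeQuadratic_le (hg : IsWeilTest g) {c : ℝ}
    (hsupp : tsupport g ⊆ Icc (-c) c) (hc : c < Real.log 4) :
    |weilThreePrimeQuadratic g - weilTwoPrimeQuadratic g| ≤ Real.log 2 / 2 * weilNorm2Sq g := by
  rw [weilThreePrimeQuadratic_sub_weilTwoPrimeQuadratic hg]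
  have hk := norm_weilConv_weilReflect_add_neg_le hg hsupp hc
  have hre := Complex.abs_re_le_norm
    (weilConv g (weilReflect g) (Real.log 4) + weilConv g (weilReflect g) (-Real.log 4))
  have hlog : 0 ≤ Real.log 2 / 2 := by positivity
  unfold weilNorm2Sq
  rw [abs_mul, abs_neg, abs_of_nonneg hlog]
  exact mul_le_mul_of_nonneg_left (hre.trans hk) hlog

/-- **One-sided form**: `E₂₃(g) − (log 2)/2 · ‖g‖₂² ≤ E₂₃₄(g)` for `tsupport g ⊆ [-c, c]`, `c < log 4`.  A two-prime
certificate at level `β₂₃` therefore certifies the `{2,3,4}`-form at level `β₂₃ − (log 2)/2`. [cite: Yoshida1992, §2 eq. (2.1) (the p^m = 4 term); Bombieri2000, §4 Lemma 2] -/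
theorem weilTwoPrimeQuadratic_sub_le_weilThreePrimeQuadratic (hg : IsWeilTest g) {c : ℝ}
    (hsupp : tsupport g ⊆ Icc (-c) c) (hc : c < Real.log 4) :
    weilTwoPrimeQuadratic g - Real.log 2 / 2 * weilNorm2Sq g ≤ weilThreePrimeQuadratic g := by
  have h := abs_weilThreePrimeQuadratic_sub_weilTwoPrimeQuadratic_le hg hsupp hc
  rw [abs_le] at h
  linarith [h.1]

/-- The same for Weil's functional itself on the `{2,3,4}`-window: for `tsupport g ⊆ [-c, c]` with `c ≤ (log 5)/2`,
`E₂₃(g) − (log 2)/2 · ‖g‖₂² ≤ Re Q(g)`. [cite: Yoshida1992, §2 eq. (2.1) (the p^m = 4 term); Bombieri2000, §4 Lemma 2] -/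
theorem weilTwoPrimeQuadratic_sub_le_weilQuadratic_re (hg : IsWeilTest g) {c : ℝ}
    (hsupp : tsupport g ⊆ Icc (-c) c) (hc : c ≤ Real.log 5 / 2) :
    weilTwoPrimeQuadratic g - Real.log 2 / 2 * weilNorm2Sq g ≤ (weilQuadratic g).re := by
  have hsupp' : tsupport g ⊆ Icc (-(Real.log 5 / 2)) (Real.log 5 / 2) :=
    hsupp.trans (Icc_subset_Icc (by linarith) hc)
  have h54 : Real.log 5 / 2 < Real.log 4 := by
    have h5 : Real.log 5 < Real.log 16 := Real.log_lt_log (by norm_num) (by norm_num)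
    have h16 : Real.log 16 = 2 * Real.log 4 := by
      rw [show (16 : ℝ) = 4 ^ 2 by norm_num, Real.log_pow]; push_cast; ring
    linarith
  rw [weilQuadratic_re_eq_weilThreePrimeQuadratic hg hsupp']
  exact weilTwoPrimeQuadratic_sub_le_weilThreePrimeQuadratic hg hsupp (lt_of_le_of_lt hc h54)

end Literature.NumberTheory.LFunctions

end
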